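import Summits.NavierStokesRegularity.NavierStokesRegularity.Theorems.AxisymmetricExtremalityAxisymmetricKatoGlobalStubSeregin2020TypeIILemma22MoserIteration
import Summits.NavierStokesRegularity.NavierStokesRegularity.Theorems.AxisymmetricExtremalityAxisymmetricKatoGlobalStubSeregin2020TypeIILemma22MoserStep
import HarnessLib

/-!
# Seregin 2020, Lemma 2.2 (after Nazarov–Uraltseva 2012): the registered atom
# `lemma22_smallSublevel_lowerBound` (N–U Lemma 3.1 + Cor 3.1 (2) + Remark 6, energy class)

Helper toward the stub `stub_seregin2020TypeII` of the crux `AxisymmetricKatoGlobal` (Seregin 2020,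
Thm 2.1 ⇐ Lemma 2.2 = N–U Lemma 4.2 in class 𝒱; piece L22-C). The atom follows from the landed
one-step estimate `lemma22_moserStep` (M1) by the landed iteration
`lemma22_smallSublevel_lowerBound_of_moserStep` (M2). Registered stub of
stmt-NavierStokesRegularity-15453, v2 text. No NS statement is proved.

## References

* A. I. Nazarov, N. N. Uraltseva, St. Petersburg Math. J. 23 (2012) = arXiv:1011.1888, Lemma 3.1,
  Cor 3.1 (2), Remark 6. [NazarovUraltseva2012]
* G. Seregin, Anal. Math. Phys. 10 (2020) 46 = arXiv:2006.04140, Lemma 2.2. [Seregin2020]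
-/

-- the problem directory repeats the summit name (D-0017); core's `dupNamespace` linter fires
set_option linter.dupNamespace false

noncomputable section

open MeasureTheory Set Function Filter Topology TopologicalSpace Metric
open scoped NNReal ENNReal

namespace Summit.NavierStokesRegularity.NavierStokesRegularity.Theorems.AxisymmetricKatoGlobal.EulerScaling

open Literature.Analysis.FluidPDE Literature.Analysis.FluidPDE.Seregin2020

/-- **N–U Lemma 3.1 + Cor 3.1 (2) + Remark 6 in the energy class (atom L3.1′ of Lemma 2.2,
registered text).** [cite: NazarovUraltseva2012, Lemma 3.1, Cor 3.1 (2), Remark 6] -/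
theorem lemma22_smallSublevel_lowerBound : ∀ (lamlo θlo θhi : ℝ) (N : ℝ≥0), 1 < lamlo → lamlo ≤ 2 → 0 < θlo → θlo ≤ θhi → ∃ μ₁ : ℝ, 0 < μ₁ ∧ ∀ (Φ : ℝ → EuclideanSpace ℝ (Fin 3) → ℝ) (U : ℝ → EuclideanSpace ℝ (Fin 3) → EuclideanSpace ℝ (Fin 3)) (S : Set (ℝ × EuclideanSpace ℝ (Fin 3))) (k R : ℝ), (0 < k ∧ 0 < R ∧ Measurable (uncurry Φ) ∧ AEStronglyMeasurable (uncurry U) volume ∧ IsClosed S ∧ (∀ z ∈ S, cylRadius z.2 = 0) ∧ ContinuousOn (uncurry Φ) ({z : ℝ × EuclideanSpace ℝ (Fin 3) | z.1 < 0} \ S) ∧ (∀ t x, 0 ≤ Φ t x) ∧ (∀ᵐ t : ℝ, t ∈ Ioo (-R ^ 2) 0 → ContDiff ℝ 1 (Φ t)) ∧ (∫⁻ s in Ioo (-R ^ 2) 0, (∫⁻ y in ball (0 : EuclideanSpace ℝ (Fin 3)) (2 * R), ‖U s y‖ₑ ^ (3 : ℕ)) ^ (4 / 3 : ℝ) ≤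 (N : ℝ≥0∞) * ENNReal.ofReal R ^ 2) ∧ (∀ (H : ℝ → ℝ), ContDiff ℝ 2 H → (∀ v, deriv H v ≤ 0) → (∀ v, 0 ≤ H v) → (∀ v, 0 ≤ deriv (deriv H) v) → (∀ v, deriv H v ^ 2 ≤ 2 * H v * deriv (deriv H) v) → (∀ v, k ≤ v → H v = 0) → ∀ (Θ : EuclideanSpace ℝ (Fin 3) → ℝ), ContDiff ℝ 1 Θ → HasCompactSupport Θ → tsupport Θ ⊆ ball (0 : EuclideanSpace ℝ (Fin 3)) (2 * R) → ∀ (η : ℝ → ℝ), ContDiff ℝ 1 η → (∀ s, 0 ≤ η s) → ∀ (t₁ t₂ : ℝ), -R ^ 2 < t₁ → t₁ ≤ t₂ → t₂ < 0 → ENNReal.ofReal (η t₂ * ∫ x, H (Φ t₂ x) * Θ x ^ 2) + ∫⁻ z in Icc t₁ t₂ ×ˢ (univ : Set (EuclideanSpace ℝ (Fin 3))), ENNReal.ofReal (1 / 2 * η z.1 * (deriv (deriv H) (Φ z.1 z.2) * ‖gradient (Φ z.1) z.2‖ ^ 2 * Θ z.2 ^ 2)) ≤ ENNReal.ofReal (η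 t₁ * (∫ x, H (Φ t₁ x) * Θ x ^ 2) + (4 * ∫ z in Icc t₁ t₂ ×ˢ (univ : Set (EuclideanSpace ℝ (Fin 3))), η z.1 * (H (Φ z.1 z.2) * ‖gradient Θ z.2‖ ^ 2)) + (∫ z in Icc t₁ t₂ ×ˢ (univ : Set (EuclideanSpace ℝ (Fin 3))), η z.1 * (H (Φ z.1 z.2) * inner ℝ (U z.1 z.2) (gradient (fun y => Θ y ^ 2) z.2))) + (∫ z in Icc t₁ t₂ ×ˢ (univ : Set (EuclideanSpace ℝ (Fin 3))), η z.1 * (2 / cylRadius z.2 * (H (Φ z.1 z.2) * fderiv ℝ (fun y => Θ y ^ 2) z.2 (eR z.2)))) + (∫ z in Icc t₁ t₂ ×ˢ (univ : Set (EuclideanSpace ℝ (Fin 3))), |deriv η z.1| * (H (Φ z.1 z.2) * Θ z.2 ^ 2))))) → ∀ (lam ρ θ t₀ l : ℝ), lamlo ≤ lam → lam ≤ 2 → R / 4 ≤ ρ → lam * ρ ≤ 2 * R → θlo ≤ θ → θ ≤ θhi → t₀ ≤ 0 → -R ^ 2 < t₀ - θ * ρ ^ 2 → 0 < l → l ≤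 k → volume {z : ℝ × EuclideanSpace ℝ (Fin 3) | z ∈ Ioo (t₀ - θ * ρ ^ 2) t₀ ×ˢ ball (0 : EuclideanSpace ℝ (Fin 3)) (lam * ρ) ∧ Φ z.1 z.2 < l} ≤ ENNReal.ofReal μ₁ * volume (Ioo (t₀ - θ * ρ ^ 2) t₀ ×ˢ ball (0 : EuclideanSpace ℝ (Fin 3)) (lam * ρ)) → (∀ᵐ z ∂(volume.restrict (Ioo (t₀ - θ / 2 * ρ ^ 2) t₀ ×ˢ ball (0 : EuclideanSpace ℝ (Fin 3)) ρ)), l / 2 ≤ Φ z.1 z.2) ∧ ((∀ᵐ x ∂(volume.restrict (ball (0 : EuclideanSpace ℝ (Fin 3)) (lam * ρ))), l ≤ Φ (t₀ - θ * ρ ^ 2) x) → ∀ᵐ z ∂(volume.restrict (Ioo (t₀ - θ * ρ ^ 2) t₀ ×ˢ ball (0 : EuclideanSpace ℝ (Fin 3)) ρ)), l / 2 ≤ Φ z.1 z.2) :=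
  lemma22_smallSublevel_lowerBound_of_moserStep lemma22_moserStep

end Summit.NavierStokesRegularity.NavierStokesRegularity.Theorems.AxisymmetricKatoGlobal.EulerScaling

end
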